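import Mathlib
import Literature.Analysis.FluidPDE.SobolevWholeSpace
import Literature.Analysis.FluidPDE.CKNInterpolationEstimate
import Literature.Analysis.FluidPDE.ClassicalLocalEnergyWindow
import HarnessLib

/-!
# Route RootDecompLitSlice — cell Uᶜ `CritTameScarIsCritical` (stmt-NavierStokesRegularity-31733):
# the CUBIC FLUX BUDGET on a terminal window from local energy and GLOBAL enstrophy

Helpers toward the Tao-vacuous cell Uᶜ (`--supports 31733`; no item, no node, no registered stub).
The terminal-window local energy budget (`LocalEnergyBudget.scar_le_of_fluxBudget`) carries the
CUBIC FLUX `m₃ ≥ ∬_{window × B_R}|u|³` as a hypothesis number. Its discharge from frame data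
(local energy `a`, window length `τ`, global window enstrophy `G`) is Hölder on the ball + the
whole-space Sobolev inequality + Young/Hölder in time — `L³ ⊂ L²∩L⁶` interpolation, the textbook
`‖u‖³_{L³} ≤ ‖u‖^{3/2}_{L²}‖u‖^{3/2}_{L⁶}`. Route-free (no `Theses` import):

* `CubicFlux.lintegral_ball_enorm_cube_le` — for a `C¹` field `v ∈ L²(ℝ³; ℝ³)` and any ball,
  `∫⁻_{B}‖v‖ₑ³ ≤ (∫⁻_{B}‖v‖ₑ²)^{3/4} · K^{3/2} · (∫⁻ |∇v|²_F)^{3/4}` with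
  `K = SNormLESNormFDerivOfEqConst ℝ³ volume 2` (Hölder `3 = 3/2 + 3/2` with exponents `4/3, 4`,
  then `‖v‖_{L⁶} ≤ K‖Dv‖_{L²}` — the tree's `eLpNorm_six_le_eLpNorm_fderiv_two` — and
  `‖Dv‖_{L²} ≤ (∫⁻|∇v|²_F)^{1/2}`, operator vs Frobenius norm);
* `CubicFlux.rpow_threeQuarters_le_young` — Young's inequality in the form used for the time
  integration: `x^{3/4} ≤ (3c/4)·x + c⁻³/4` on `[0,∞]`, every `c > 0`;
* `CubicFlux.cubicFlux_le_young`, ★ `CubicFlux.cubicFlux_le` — THE CUBIC FLUX BUDGET on the frame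
  (classical on `[0,T) × ℝ³`, Leray–Hopf on `[0,T]`): if `∫_{B(x₀,R)}|u(s)|² ≤ a` on `[T − τ, T)`
  and the window enstrophy `∫_{T−τ}^{T}∫|∇u|²_F ≤ G`, then for every `t₁ ∈ (T − τ, T)`
  `∬_{(T−τ,t₁)×B(x₀,R)}|u|³ ≤ K^{3/2} a^{3/4} τ^{1/4} G^{3/4}` (Fubini over the tree's
  `integrableOn_norm_pow_three_window`, the slice bound, Young/Hölder in time). This discharges the
  hypothesis number `m₃` of `LocalEnergyBudget.scar_le_of_fluxBudget`; `G` itself is paid by the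
  energy drop (`EnergyDrain.dissipation_le_energy_sub`: `ν G ≤ E(u(T−τ)) − E(u T)`) and the drop
  by the `L²`-modulus (`GeneralWindowTradeoff.stub_energyDrop_le_modulus`: `≤ 2‖u₀‖₂√H`), both
  landed — kept out of this file so that it imports no `Theses` module.

HONEST FRAMING: helper lemmas INSIDE the Tao-vacuous cell Uᶜ; zero load of the route moves
(ROOT ⟺ U ∧ P1, critic rows 354/371/563/639/665); no item is re-typed. Rung 0: nothing here proves
NS regularity. Decomp-ns route-writer g39. [folklore]
-/

set_option linter.dupNamespace false

noncomputable section

namespace Summit.NavierStokesRegularity.NavierStokesRegularity.Theorems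

open MeasureTheory TopologicalSpace Set Function Filter Metric
open _root_.Topology
open scoped InnerProductSpace RealInnerProductSpace ENNReal NNReal ContDiff
open Literature.Analysis.FluidPDE

namespace CubicFlux

/-- **Young's inequality, `3/4`-power form on `[0,∞]`**: `x^{3/4} ≤ (3c/4)x + c⁻³/4` for every
`c > 0` (weighted AM–GM for `(cx)^{3/4}(c⁻³)^{1/4} = x^{3/4}`). [folklore] -/
theorem rpow_threeQuarters_le_young (x : ℝ≥0∞) {c : ℝ} (hc : 0 < c) :
    x ^ (3 / 4 : ℝ) ≤ ENNReal.ofReal (3 / 4 * c) * x + ENNReal.ofReal (4⁻¹ * c⁻¹ ^ 3) := by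
  rcases eq_or_ne x ⊤ with hx | hx
  · rw [hx, ENNReal.mul_top (by rw [Ne, ENNReal.ofReal_eq_zero, not_le]; positivity)]
    simp
  · -- the real case
    set r : ℝ := x.toReal with hr
    have hr0 : 0 ≤ r := ENNReal.toReal_nonneg
    have hxr : x = ENNReal.ofReal r := (ENNReal.ofReal_toReal hx).symm
    have hreal : r ^ (3 / 4 : ℝ) ≤ 3 / 4 * (c * r) + 4⁻¹ * c⁻¹ ^ 3 := by
      have hw := Real.geom_mean_le_arith_mean2_weighted (w₁ := 3 / 4) (w₂ := 4⁻¹)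
        (p₁ := c * r) (p₂ := c⁻¹ ^ 3) (by norm_num) (by norm_num) (by positivity) (by positivity)
        (by norm_num)
      have hid : (c * r) ^ (3 / 4 : ℝ) * (c⁻¹ ^ 3) ^ (4⁻¹ : ℝ) = r ^ (3 / 4 : ℝ) := by
        rw [Real.mul_rpow hc.le hr0, show (c⁻¹ ^ 3 : ℝ) = c⁻¹ ^ (3 : ℝ) by norm_cast,
          ← Real.rpow_mul (inv_nonneg.2 hc.le), show (3 : ℝ) * 4⁻¹ = 3 / 4 by norm_num,
          Real.inv_rpow hc.le]
        have hc34 : 0 < c ^ (3 / 4 : ℝ) := Real.rpow_pos_of_pos hc _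
        field_simp
      rw [hid] at hw
      linarith
    rw [hxr, ENNReal.ofReal_rpow_of_nonneg hr0 (by norm_num), ← ENNReal.ofReal_mul (by positivity),
      ← ENNReal.ofReal_add (by positivity) (by positivity)]
    exact ENNReal.ofReal_le_ofReal (by linarith)

/-- `(4/3, 4)` are Hölder conjugate. [folklore] -/
theorem holderConjugate_fourThirds_four : (4 / 3 : ℝ).HolderConjugate 4 :=
  Real.holderConjugate_iff.2 ⟨by norm_num, by norm_num⟩

/-- **Hölder on a set: `∫⁻‖v‖ₑ³ ≤ (∫⁻‖v‖ₑ²)^{3/4}(∫⁻‖v‖ₑ⁶)^{1/4}`** (exponents `4/3`, `4` on the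
splitting `‖v‖³ = ‖v‖^{3/2}·‖v‖^{3/2}`), for a continuous field and any measure. [folklore] -/
theorem lintegral_enorm_cube_le_holder {α : Type*} [MeasurableSpace α] (μ : Measure α)
    {F : Type*} [NormedAddCommGroup F] {v : α → F} (hv : AEStronglyMeasurable v μ) :
    ∫⁻ x, ‖v x‖ₑ ^ 3 ∂μ ≤
      (∫⁻ x, ‖v x‖ₑ ^ 2 ∂μ) ^ (3 / 4 : ℝ) * (∫⁻ x, ‖v x‖ₑ ^ 6 ∂μ) ^ (4⁻¹ : ℝ) := by
  have hm : AEMeasurable (fun x => ‖v x‖ₑ ^ (3 / 2 : ℝ)) μ := hv.enorm.pow_const _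
  have hH := ENNReal.lintegral_mul_le_Lp_mul_Lq μ holderConjugate_fourThirds_four hm hm
  have e1 : ∀ x, ‖v x‖ₑ ^ (3 / 2 : ℝ) * ‖v x‖ₑ ^ (3 / 2 : ℝ) = ‖v x‖ₑ ^ 3 := fun x => by
    rw [← ENNReal.rpow_add_of_nonneg _ _ (by norm_num) (by norm_num),
      show (3 / 2 : ℝ) + 3 / 2 = (3 : ℕ) by norm_num, ENNReal.rpow_natCast]
  have e2 : ∀ x, (‖v x‖ₑ ^ (3 / 2 : ℝ)) ^ (4 / 3 : ℝ) = ‖v x‖ₑ ^ 2 := fun x => by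
    rw [← ENNReal.rpow_mul, show (3 / 2 : ℝ) * (4 / 3) = (2 : ℕ) by norm_num, ENNReal.rpow_natCast]
  have e3 : ∀ x, (‖v x‖ₑ ^ (3 / 2 : ℝ)) ^ (4 : ℝ) = ‖v x‖ₑ ^ 6 := fun x => by
    rw [← ENNReal.rpow_mul, show (3 / 2 : ℝ) * 4 = (6 : ℕ) by norm_num, ENNReal.rpow_natCast]
  simp only [Pi.mul_apply, e1, e2, e3] at hH
  rw [show (1 : ℝ) / (4 / 3) = 3 / 4 by norm_num, show (1 : ℝ) / 4 = 4⁻¹ by norm_num] at hH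
  exact hH

/-- **`∫⁻ ‖v‖ₑ⁶ ≤ K⁶ (∫⁻ |∇v|²_F)³` on `ℝ³`** for a `C¹` field `v ∈ L²` (the whole-space Sobolev
inequality `‖v‖_{L⁶} ≤ K‖Dv‖_{L²}`, tree `eLpNorm_six_le_eLpNorm_fderiv_two`, and
`‖Dv‖_{L²} ≤ (∫⁻|∇v|²_F)^{1/2}`, tree `eLpNorm_two_le_lintegral_frobeniusNormSq_rpow`).
[cite: Evans2010, §5.6.1 Thm. 1–2] -/
theorem lintegral_enorm_six_le_sobolev
    (v : EuclideanSpace ℝ (Fin 3) → EuclideanSpace ℝ (Fin 3)) (hv : ContDiff ℝ 1 v)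
    (hv2 : MemLp v 2 volume) :
    ∫⁻ x, ‖v x‖ₑ ^ 6 ≤
      ((SNormLESNormFDerivOfEqConst (EuclideanSpace ℝ (Fin 3))
          (volume : Measure (EuclideanSpace ℝ (Fin 3))) 2 : ℝ≥0∞) ^ (6 : ℝ)) *
        (∫⁻ x, ENNReal.ofReal (frobeniusNormSq (fderiv ℝ v x))) ^ (3 : ℝ) := by
  set K : ℝ≥0 := SNormLESNormFDerivOfEqConst (EuclideanSpace ℝ (Fin 3))
    (volume : Measure (EuclideanSpace ℝ (Fin 3))) 2 with hK
  set Fv : ℝ≥0∞ := ∫⁻ x, ENNReal.ofReal (frobeniusNormSq (fderiv ℝ v x)) with hFv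
  have hS : eLpNorm v 6 volume ≤ K * eLpNorm (fderiv ℝ v) 2 volume :=
    eLpNorm_six_le_eLpNorm_fderiv_two volume finrank_euclideanSpace_fin hv hv2.eLpNorm_lt_top
  have hD : eLpNorm (fderiv ℝ v) 2 volume ≤ Fv ^ (1 / 2 : ℝ) :=
    eLpNorm_two_le_lintegral_frobeniusNormSq_rpow volume (fderiv ℝ v)
  have h6 : eLpNorm v 6 volume = (∫⁻ x, ‖v x‖ₑ ^ 6) ^ (1 / 6 : ℝ) := by
    rw [eLpNorm_eq_lintegral_rpow_enorm_toReal (by norm_num) (by norm_num), ENNReal.toReal_ofNat]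
    congr 2
    funext x
    rw [show (6 : ℝ) = (6 : ℕ) by norm_num, ENNReal.rpow_natCast]
  have hpow : (∫⁻ x, ‖v x‖ₑ ^ 6) = eLpNorm v 6 volume ^ (6 : ℝ) := by
    rw [h6, ← ENNReal.rpow_mul, show (1 / 6 : ℝ) * 6 = 1 by norm_num, ENNReal.rpow_one]
  rw [hpow]
  calc eLpNorm v 6 volume ^ (6 : ℝ) ≤ ((K : ℝ≥0∞) * Fv ^ (1 / 2 : ℝ)) ^ (6 : ℝ) := by
        gcongr
        exact hS.trans (by gcongr)
    _ = (K : ℝ≥0∞) ^ (6 : ℝ) * Fv ^ (3 : ℝ) := by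
        rw [ENNReal.mul_rpow_of_nonneg _ _ (by norm_num), ← ENNReal.rpow_mul]
        norm_num

/-- ★ **The cubic mass on a ball from local energy and global enstrophy (slice form).** For a `C¹`
field `v ∈ L²(ℝ³; ℝ³)`, any centre and radius:
`∫⁻_{B(x₀,R)}‖v‖ₑ³ ≤ (∫⁻_{B(x₀,R)}‖v‖ₑ²)^{3/4} · (K^{3/2} · (∫⁻ |∇v|²_F)^{3/4})`,
`K = SNormLESNormFDerivOfEqConst ℝ³ volume 2` — i.e. `‖v‖³_{L³(B)} ≤ K^{3/2}‖v‖^{3/2}_{L²(B)}‖∇v‖^{3/2}_{L²(ℝ³)}`.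
[cite: Evans2010, §5.6.1 Thm. 1–2] -/
theorem lintegral_ball_enorm_cube_le
    (v : EuclideanSpace ℝ (Fin 3) → EuclideanSpace ℝ (Fin 3)) (hv : ContDiff ℝ 1 v)
    (hv2 : MemLp v 2 volume) (x₀ : EuclideanSpace ℝ (Fin 3)) (R : ℝ) :
    ∫⁻ x in ball x₀ R, ‖v x‖ₑ ^ 3 ≤
      (∫⁻ x in ball x₀ R, ‖v x‖ₑ ^ 2) ^ (3 / 4 : ℝ) *
        (((SNormLESNormFDerivOfEqConst (EuclideanSpace ℝ (Fin 3))
            (volume : Measure (EuclideanSpace ℝ (Fin 3))) 2 : ℝ≥0∞) ^ (3 / 2 : ℝ)) *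
          (∫⁻ x, ENNReal.ofReal (frobeniusNormSq (fderiv ℝ v x))) ^ (3 / 4 : ℝ)) := by
  set K : ℝ≥0 := SNormLESNormFDerivOfEqConst (EuclideanSpace ℝ (Fin 3))
    (volume : Measure (EuclideanSpace ℝ (Fin 3))) 2 with hK
  set Fv : ℝ≥0∞ := ∫⁻ x, ENNReal.ofReal (frobeniusNormSq (fderiv ℝ v x)) with hFv
  have hH := lintegral_enorm_cube_le_holder (volume.restrict (ball x₀ R))
    (hv.continuous.aestronglyMeasurable (μ := volume.restrict (ball x₀ R)))
  refine hH.trans ?_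
  gcongr
  -- `(∫⁻_B ‖v‖ₑ⁶)^{1/4} ≤ (∫⁻ ‖v‖ₑ⁶)^{1/4} ≤ (K⁶ Fv³)^{1/4} = K^{3/2} Fv^{3/4}`
  have h1 : ∫⁻ x in ball x₀ R, ‖v x‖ₑ ^ 6 ≤ ∫⁻ x, ‖v x‖ₑ ^ 6 :=
    lintegral_mono' Measure.restrict_le_self le_rfl
  have h2 := lintegral_enorm_six_le_sobolev v hv hv2
  calc (∫⁻ x in ball x₀ R, ‖v x‖ₑ ^ 6) ^ (4⁻¹ : ℝ)
      ≤ (((K : ℝ≥0∞) ^ (6 : ℝ)) * Fv ^ (3 : ℝ)) ^ (4⁻¹ : ℝ) := by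
        gcongr
        exact h1.trans h2
    _ = (K : ℝ≥0∞) ^ (3 / 2 : ℝ) * Fv ^ (3 / 4 : ℝ) := by
        rw [ENNReal.mul_rpow_of_nonneg _ _ (by norm_num), ← ENNReal.rpow_mul, ← ENNReal.rpow_mul]
        norm_num

/-! ## The terminal-window cubic flux from frame data -/

/-- **Fubini + slice bound: the cubic flux on a terminal sub-window, Young form.** Frame: classical
on `[0,T) × ℝ³`, Leray–Hopf on `[0,T]`. For a window `(T − τ, T)`, a sub-window end `t₁ < T`,
a local energy bound `∫_{B(x₀,R)}|u(s)|² ≤ a` on `[T − τ, T)` and a window enstrophy bound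
`∫_{T−τ}^{T}∫|∇u|²_F ≤ G`, for every `c > 0`:
`∬_{(T−τ,t₁)×B(x₀,R)}|u|³ ≤ K^{3/2} a^{3/4} (¾ c G + ¼ c⁻³ τ)`, `K` the Sobolev constant
(`lintegral_ball_enorm_cube_le` on each slice, Young `F^{3/4} ≤ ¾cF + ¼c⁻³` in time).
[cite: Evans2010, §5.6.1 Thm. 1–2] -/
theorem cubicFlux_le_young {ν T : ℝ}
    {u : ℝ → EuclideanSpace ℝ (Fin 3) → EuclideanSpace ℝ (Fin 3)}
    {p : ℝ → EuclideanSpace ℝ (Fin 3) → ℝ}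
    (hcl : IsClassicalNSSolutionOn (Set.Ico 0 T) ν 0 u p) (hLH : IsLerayHopfOn T ν 0 (u 0) u)
    (x₀ : EuclideanSpace ℝ (Fin 3)) (R : ℝ) {τ t₁ a G c : ℝ} (hτT : τ < T)
    (ht₁ : t₁ ∈ Ioo (T - τ) T)
    (ha : ∀ s ∈ Ico (T - τ) T, ∫ x in ball x₀ R, ‖u s x‖ ^ 2 ≤ a) (hG : 0 ≤ G)
    (hGw : ∫⁻ t in Ioo (T - τ) T, ∫⁻ x, ENNReal.ofReal (frobeniusNormSq (fderiv ℝ (u t) x)) ≤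
      ENNReal.ofReal G)
    (hc : 0 < c) :
    ∫ z in Ioo (T - τ) t₁ ×ˢ ball x₀ R, ‖u z.1 z.2‖ ^ 3 ≤
      ((SNormLESNormFDerivOfEqConst (EuclideanSpace ℝ (Fin 3))
          (volume : Measure (EuclideanSpace ℝ (Fin 3))) 2 : ℝ≥0) : ℝ) ^ (3 / 2 : ℝ) *
        a ^ (3 / 4 : ℝ) * (3 / 4 * c * G + 4⁻¹ * c⁻¹ ^ 3 * τ) := by
  set K : ℝ≥0 := SNormLESNormFDerivOfEqConst (EuclideanSpace ℝ (Fin 3))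
    (volume : Measure (EuclideanSpace ℝ (Fin 3))) 2 with hK
  set F : ℝ → ℝ≥0∞ := fun t => ∫⁻ x, ENNReal.ofReal (frobeniusNormSq (fderiv ℝ (u t) x)) with hF
  have hτ : 0 < τ := by linarith [ht₁.1, ht₁.2]
  have h0 : 0 ≤ T - τ := sub_nonneg.2 hτT.le
  have ha0 : 0 ≤ a :=
    (integral_nonneg fun x => by positivity).trans (ha (T - τ) ⟨le_rfl, by linarith⟩)
  set I : Set ℝ := Ioo (T - τ) t₁ with hIdef
  set B : Set (EuclideanSpace ℝ (Fin 3)) := ball x₀ R with hBdef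
  have hI : Icc (T - τ) t₁ ⊆ Set.Ico 0 T := fun s hs =>
    ⟨h0.trans hs.1, lt_of_le_of_lt hs.2 ht₁.2⟩
  -- Fubini: `∬ = ∫_I c₃`
  have hprod : (volume : Measure (ℝ × EuclideanSpace ℝ (Fin 3))).restrict (I ×ˢ B) =
      (volume.restrict I).prod (volume.restrict B) := by
    rw [Measure.volume_eq_prod, Measure.prod_restrict]
  have i3 : Integrable (fun z : ℝ × EuclideanSpace ℝ (Fin 3) => ‖u z.1 z.2‖ ^ 3)
      ((volume.restrict I).prod (volume.restrict B)) := by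
    rw [← hprod]; exact hcl.integrableOn_norm_pow_three_window hI x₀ R
  set c₃ : ℝ → ℝ := fun s => ∫ x in B, ‖u s x‖ ^ 3 with hc₃
  have hc₃I : Integrable c₃ (volume.restrict I) := i3.integral_prod_left
  have hc₃eq : ∫ z in I ×ˢ B, ‖u z.1 z.2‖ ^ 3 = ∫ s in I, c₃ s := by
    rw [show (∫ z in I ×ˢ B, ‖u z.1 z.2‖ ^ 3) = ∫ z, ‖u z.1 z.2‖ ^ 3
      ∂((volume.restrict I).prod (volume.restrict B)) by rw [← hprod]]
    exact integral_prod _ i3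
  have hc₃nn : ∀ s, 0 ≤ c₃ s := fun s => integral_nonneg fun x => by positivity
  -- the slice bound on `I`, in `ℝ≥0∞`
  have hslice : ∀ s ∈ I, ENNReal.ofReal (c₃ s) ≤
      ENNReal.ofReal a ^ (3 / 4 : ℝ) * ((K : ℝ≥0∞) ^ (3 / 2 : ℝ)) *
        (ENNReal.ofReal (3 / 4 * c) * F s + ENNReal.ofReal (4⁻¹ * c⁻¹ ^ 3)) := by
    intro s hs
    have hsS : s ∈ Set.Ico 0 T := ⟨h0.trans hs.1.le, hs.2.trans ht₁.2⟩
    have hC1 : ContDiff ℝ 1 (u s) := (hcl.contDiff_velocity hsS).of_le (by norm_cast)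
    have hmem : MemLp (u s) 2 volume := hLH.memLp s ⟨hsS.1, hsS.2.le⟩
    have hcont : Continuous (u s) := hC1.continuous
    have hint : ∀ n : ℕ, IntegrableOn (fun x => ‖u s x‖ ^ n) B volume := fun n =>
      ((hcont.norm.pow n).continuousOn.integrableOn_compact
        (isCompact_closedBall x₀ R)).mono_set ball_subset_closedBall
    have e3 : ENNReal.ofReal (c₃ s) = ∫⁻ x in B, ‖u s x‖ₑ ^ 3 := by
      rw [hc₃, ofReal_integral_eq_lintegral_ofReal (hint 3) (ae_of_all _ fun x => by positivity)]
      refine lintegral_congr fun x => ?_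
      rw [ENNReal.ofReal_pow (norm_nonneg _), ofReal_norm]
    have e2 : ∫⁻ x in B, ‖u s x‖ₑ ^ 2 = ENNReal.ofReal (∫ x in B, ‖u s x‖ ^ 2) := by
      rw [ofReal_integral_eq_lintegral_ofReal (hint 2) (ae_of_all _ fun x => by positivity)]
      refine lintegral_congr fun x => ?_
      rw [ENNReal.ofReal_pow (norm_nonneg _), ofReal_norm]
    have h2a : ∫⁻ x in B, ‖u s x‖ₑ ^ 2 ≤ ENNReal.ofReal a := by
      rw [e2]; exact ENNReal.ofReal_le_ofReal (ha s ⟨hs.1.le, hs.2.trans ht₁.2⟩)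
    rw [e3]
    calc ∫⁻ x in B, ‖u s x‖ₑ ^ 3
        ≤ (∫⁻ x in B, ‖u s x‖ₑ ^ 2) ^ (3 / 4 : ℝ) *
            (((K : ℝ≥0∞) ^ (3 / 2 : ℝ)) * F s ^ (3 / 4 : ℝ)) :=
          lintegral_ball_enorm_cube_le (u s) hC1 hmem x₀ R
      _ ≤ ENNReal.ofReal a ^ (3 / 4 : ℝ) * (((K : ℝ≥0∞) ^ (3 / 2 : ℝ)) *
            (ENNReal.ofReal (3 / 4 * c) * F s + ENNReal.ofReal (4⁻¹ * c⁻¹ ^ 3))) := by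
          exact mul_le_mul' (ENNReal.rpow_le_rpow h2a (by norm_num))
            (mul_le_mul' le_rfl (rpow_threeQuarters_le_young _ hc))
      _ = _ := by ring
  -- integrate over `I`
  have hCtop : ENNReal.ofReal a ^ (3 / 4 : ℝ) * ((K : ℝ≥0∞) ^ (3 / 2 : ℝ)) ≠ ⊤ :=
    ENNReal.mul_ne_top (ENNReal.rpow_ne_top_of_nonneg (by norm_num) ENNReal.ofReal_ne_top)
      (ENNReal.rpow_ne_top_of_nonneg (by norm_num) ENNReal.coe_ne_top)
  have hvolI : volume I ≤ ENNReal.ofReal τ := by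
    rw [hIdef, Real.volume_Ioo]
    exact ENNReal.ofReal_le_ofReal (by linarith [ht₁.2])
  have hFI : ∫⁻ s in I, F s ≤ ENNReal.ofReal G :=
    (lintegral_mono_set (Ioo_subset_Ioo le_rfl ht₁.2.le)).trans hGw
  have hmain : ∫⁻ s in I, ENNReal.ofReal (c₃ s) ≤
      ENNReal.ofReal a ^ (3 / 4 : ℝ) * ((K : ℝ≥0∞) ^ (3 / 2 : ℝ)) *
        (ENNReal.ofReal (3 / 4 * c) * ENNReal.ofReal G +
          ENNReal.ofReal (4⁻¹ * c⁻¹ ^ 3) * ENNReal.ofReal τ) := by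
    calc ∫⁻ s in I, ENNReal.ofReal (c₃ s)
        ≤ ∫⁻ s in I, ENNReal.ofReal a ^ (3 / 4 : ℝ) * ((K : ℝ≥0∞) ^ (3 / 2 : ℝ)) *
            (ENNReal.ofReal (3 / 4 * c) * F s + ENNReal.ofReal (4⁻¹ * c⁻¹ ^ 3)) :=
          setLIntegral_mono' measurableSet_Ioo hslice
      _ = ENNReal.ofReal a ^ (3 / 4 : ℝ) * ((K : ℝ≥0∞) ^ (3 / 2 : ℝ)) *
            (ENNReal.ofReal (3 / 4 * c) * (∫⁻ s in I, F s) +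
              ENNReal.ofReal (4⁻¹ * c⁻¹ ^ 3) * volume I) := by
          rw [lintegral_const_mul' _ _ hCtop, lintegral_add_right' _ aemeasurable_const,
            lintegral_const_mul' _ _ ENNReal.ofReal_ne_top, setLIntegral_const]
      _ ≤ _ := by gcongr
  -- back to `ℝ`
  have hKe : ((K : ℝ≥0∞) ^ (3 / 2 : ℝ)) = ENNReal.ofReal ((K : ℝ) ^ (3 / 2 : ℝ)) := by
    rw [← ENNReal.ofReal_coe_nnreal, ENNReal.ofReal_rpow_of_nonneg K.coe_nonneg (by norm_num)]
  have hRHS : ENNReal.ofReal a ^ (3 / 4 : ℝ) * ((K : ℝ≥0∞) ^ (3 / 2 : ℝ)) *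
        (ENNReal.ofReal (3 / 4 * c) * ENNReal.ofReal G +
          ENNReal.ofReal (4⁻¹ * c⁻¹ ^ 3) * ENNReal.ofReal τ) =
      ENNReal.ofReal ((K : ℝ) ^ (3 / 2 : ℝ) * a ^ (3 / 4 : ℝ) *
        (3 / 4 * c * G + 4⁻¹ * c⁻¹ ^ 3 * τ)) := by
    rw [hKe, ENNReal.ofReal_rpow_of_nonneg ha0 (by norm_num),
      ← ENNReal.ofReal_mul (by positivity), ← ENNReal.ofReal_mul (by positivity),
      ← ENNReal.ofReal_mul (by positivity), ← ENNReal.ofReal_add (by positivity) (by positivity),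
      ← ENNReal.ofReal_mul (by positivity)]
    congr 1
    ring
  have hbound : 0 ≤ (K : ℝ) ^ (3 / 2 : ℝ) * a ^ (3 / 4 : ℝ) *
      (3 / 4 * c * G + 4⁻¹ * c⁻¹ ^ 3 * τ) := by positivity
  have hfin : ENNReal.ofReal (∫ s in I, c₃ s) ≤ ENNReal.ofReal ((K : ℝ) ^ (3 / 2 : ℝ) *
      a ^ (3 / 4 : ℝ) * (3 / 4 * c * G + 4⁻¹ * c⁻¹ ^ 3 * τ)) := by
    rw [ofReal_integral_eq_lintegral_ofReal hc₃I (ae_of_all _ fun s => hc₃nn s), ← hRHS]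
    exact hmain
  rw [hc₃eq]
  exact (ENNReal.ofReal_le_ofReal_iff hbound).1 hfin

/-- ★ **THE CUBIC FLUX BUDGET from frame data (optimised form).** Same frame and hypotheses as
`cubicFlux_le_young`; then
`∬_{(T−τ,t₁)×B(x₀,R)}|u|³ ≤ K^{3/2} · a^{3/4} · τ^{1/4} · G^{3/4}`
(`c = (τ/G)^{1/4}` in the Young form; `G = 0` by letting `c → ∞`). This discharges the cubic
flux number `m₃` of `LocalEnergyBudget.scar_le_of_fluxBudget` from the local energy `a`, the
window length `τ` and the window enstrophy `G`. [cite: Evans2010, §5.6.1 Thm. 1–2] -/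
theorem cubicFlux_le {ν T : ℝ}
    {u : ℝ → EuclideanSpace ℝ (Fin 3) → EuclideanSpace ℝ (Fin 3)}
    {p : ℝ → EuclideanSpace ℝ (Fin 3) → ℝ}
    (hcl : IsClassicalNSSolutionOn (Set.Ico 0 T) ν 0 u p) (hLH : IsLerayHopfOn T ν 0 (u 0) u)
    (x₀ : EuclideanSpace ℝ (Fin 3)) (R : ℝ) {τ t₁ a G : ℝ} (hτT : τ < T)
    (ht₁ : t₁ ∈ Ioo (T - τ) T)
    (ha : ∀ s ∈ Ico (T - τ) T, ∫ x in ball x₀ R, ‖u s x‖ ^ 2 ≤ a) (hG : 0 ≤ G)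
    (hGw : ∫⁻ t in Ioo (T - τ) T, ∫⁻ x, ENNReal.ofReal (frobeniusNormSq (fderiv ℝ (u t) x)) ≤
      ENNReal.ofReal G) :
    ∫ z in Ioo (T - τ) t₁ ×ˢ ball x₀ R, ‖u z.1 z.2‖ ^ 3 ≤
      ((SNormLESNormFDerivOfEqConst (EuclideanSpace ℝ (Fin 3))
          (volume : Measure (EuclideanSpace ℝ (Fin 3))) 2 : ℝ≥0) : ℝ) ^ (3 / 2 : ℝ) *
        a ^ (3 / 4 : ℝ) * (τ ^ (1 / 4 : ℝ) * G ^ (3 / 4 : ℝ)) := by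
  set K : ℝ≥0 := SNormLESNormFDerivOfEqConst (EuclideanSpace ℝ (Fin 3))
    (volume : Measure (EuclideanSpace ℝ (Fin 3))) 2 with hK
  have hτ : 0 < τ := by linarith [ht₁.1, ht₁.2]
  have ha0 : 0 ≤ a :=
    (integral_nonneg fun x => by positivity).trans (ha (T - τ) ⟨le_rfl, by linarith⟩)
  have hM0 : 0 ≤ (K : ℝ) ^ (3 / 2 : ℝ) * a ^ (3 / 4 : ℝ) := by positivity
  rcases hG.eq_or_lt with hG0 | hGpos
  · -- `G = 0`: let `c → ∞` in the Young form
    rw [← hG0, Real.zero_rpow (by norm_num), mul_zero, mul_zero]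
    refine le_of_forall_pos_le_add fun ε hε => ?_
    set M : ℝ := (K : ℝ) ^ (3 / 2 : ℝ) * a ^ (3 / 4 : ℝ) * (4⁻¹ * τ) with hM
    have hMnn : 0 ≤ M := by positivity
    set c : ℝ := M / ε + 1 with hcdef
    have hc : 0 < c := by positivity
    have hc1 : 1 ≤ c := by
      have : 0 ≤ M / ε := by positivity
      linarith
    have hy := cubicFlux_le_young hcl hLH x₀ R hτT ht₁ ha hG hGw hc
    rw [← hG0, mul_zero, zero_add] at hy
    refine hy.trans ?_
    rw [zero_add]
    have hcinv : c⁻¹ ^ 3 ≤ c⁻¹ :=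
      pow_le_of_le_one (inv_nonneg.2 hc.le) (inv_le_one_of_one_le₀ hc1) (by norm_num)
    have hMc : M * c⁻¹ ≤ ε := by
      rw [mul_inv_le_iff₀ hc]
      have : ε * c = M + ε := by rw [hcdef]; field_simp
      linarith
    calc (K : ℝ) ^ (3 / 2 : ℝ) * a ^ (3 / 4 : ℝ) * (4⁻¹ * c⁻¹ ^ 3 * τ)
        = M * c⁻¹ ^ 3 := by rw [hM]; ring
      _ ≤ M * c⁻¹ := mul_le_mul_of_nonneg_left hcinv hMnn
      _ ≤ ε := hMc
  · -- `G > 0`: `c = (τ/G)^{1/4}`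
    set c : ℝ := (τ / G) ^ (4⁻¹ : ℝ) with hcdef
    have hc : 0 < c := Real.rpow_pos_of_pos (div_pos hτ hGpos) _
    have hc4 : c ^ 4 = τ / G := by
      rw [hcdef, ← Real.rpow_natCast, ← Real.rpow_mul (div_pos hτ hGpos).le]
      norm_num
    have hGc : G = τ / c ^ 4 := by
      rw [hc4]; field_simp
    have hkey : 3 / 4 * c * G + 4⁻¹ * c⁻¹ ^ 3 * τ = τ ^ (1 / 4 : ℝ) * G ^ (3 / 4 : ℝ) := by
      have hc3 : (c ^ 4) ^ (3 / 4 : ℝ) = c ^ 3 := by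
        rw [← Real.rpow_natCast c 4, ← Real.rpow_mul hc.le]
        norm_num
      have hτ1 : τ ^ (1 / 4 : ℝ) * τ ^ (3 / 4 : ℝ) = τ := by
        rw [← Real.rpow_add hτ]; norm_num
      rw [hGc, Real.div_rpow hτ.le (pow_nonneg hc.le 4), hc3,
        show τ ^ (1 / 4 : ℝ) * (τ ^ (3 / 4 : ℝ) / c ^ 3) = (τ ^ (1 / 4 : ℝ) * τ ^ (3 / 4 : ℝ)) / c ^ 3
          by ring, hτ1]
      field_simp
      ring
    have hy := cubicFlux_le_young hcl hLH x₀ R hτT ht₁ ha hG hGw hc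
    rwa [hkey] at hy

end CubicFlux

end Summit.NavierStokesRegularity.NavierStokesRegularity.Theorems

end
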